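import Literature.NumberTheory.EllipticCurves.MatarNekovar2019.IrreducibleOverQuadraticFieldClauseThreeProofs
import Literature.NumberTheory.EllipticCurves.SupersingularIrreducibleProofs
import Literature.NumberTheory.EllipticCurves.SerreOpenImageOrdinaryInertiaProofs
import Literature.NumberTheory.EllipticCurves.YanZhu2026.TwistGoodOrdinaryProofs
import Literature.NumberTheory.EllipticCurves.Rank1Residual.Typed.X7
import HarnessLib

/-!
# Route `SignedLowerHalves`, crux `KobayashiMainConjectureSmallImage` (item stmt-BirchSwinnertonDyer-19002):
# (irr_K) and ABSOLUTE irreducibility of `E_K[p]` over an auxiliary quadratic field `K` with `(N, d_K) = 1`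
# at a good SUPERSINGULAR odd `p` — WITHOUT surjectivity of `ρ̄_{E,p}` (cell `bsd-ssimc`, seat
# `bsd-line-slh-p3` gen 5, line `birth`; THEOREMS ONLY, helper file `--supports` item 4)

PARTITION (cell bsd-ssimc): X7 (A7) × item 4's small-image domain (odd good supersingular `p`, `ρ̄_{E,p}`
not onto = the non-CM `X_ns⁺(p)` locus). Types the image clause of every two-variable road over an
auxiliary imaginary quadratic field on that domain; closes none; crux 4 OPEN. BSD is not proved by any of
this.

## Why

On item 4's domain the two-variable roads of the sibling route `SignedBaseChange` (descent K2R⁗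
`SignedLowerDescentFromTwoVariablePackage`, its inputs `stub_muZero_of_prop422GreenbergAnyRoot` and
`productLowerDivisibility_of_package`, and the designed twin line «acns» of this crux —
`Cruxes/KobayashiMainConjectureSmallImage/AcnsSketch.lean`, idea card `heegner-primitivity-prime-to-p-image`
NOTE g3 N2) need, for the base change of `E` to an auxiliary quadratic field `K` with `(N, d_K) = 1`:
(irr_K) `E_K[p]` irreducible (the binder of BCS 2025 Prop. 4.2.2, `prop422_greenbergAnyRoot_hasUnitContent_minus`)
and, for EVERY `𝔽_p`-framing `ρ : Γ_K → GL₂(𝔽_p)` of `E_K[p]`, ABSOLUTE irreducibility (the image clause of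
the BSTW two-variable signed package `props118_27_519_exists_signedTwoVariablePackage_supersingular_PRE`).
At surjective image the tree derives both from `Surj W p` (`Rank1Residual.irrK_of_surj`,
`…SignedBaseChangeK1FrameData.irrK_framed_of_surj`); on item 4's domain `Surj W p` FAILS. This file supplies
both clauses there from PUBLISHED, tree-PROVED input instead:

* `E[p]` is irreducible over `ℚ` at an odd prime of good supersingular reduction (Serre 1972 Prop. 12; tree
  `hasIrreducibleModPGaloisRep_of_dvd_frobeniusTrace`);
* Matar–Nekovář 2019 Prop. 5.26 (2): for `K` quadratic with `(N, d_K) = 1` and `p ≠ 2`, irreducibility over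
  `ℚ` implies (irr_K) — tree-PROVED `MatarNekovar2019.prop526_hasIrreducibleModPGaloisRep_baseChange_holds`;
* Matar–Nekovář 2019 Prop. 5.26 (3): (irr_K) is absolute unless `(p, d_K) = (3, -3)` — tree-PROVED
  `MatarNekovar2019.prop526_three_of_irreducible_of_not_isAbsolutelyIrreducible_holds`; when `p` SPLITS in `K`
  (the auxiliary fields of the two-variable roads) `p ∤ d_K`, so the exception is void at every `p`.

## What this file proves

* `hasIrreducibleModPGaloisRep_baseChange_of_goodSS_of_isCoprime` — (irr_K) for `E_K[p]`: `p ≠ 2`, `E` good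
  at `p` with `p ∣ a_p`, `[K : ℚ] = 2`, `(N_E, d_K) = 1`; NO image hypothesis.
* `isAbsolutelyIrreducible_baseChange_of_goodSS_of_isCoprime` — every framing of `E_K[p]` is absolutely
  irreducible, under the extra clause `¬ (p = 3 ∧ d_K = -3)`;
  `isAbsolutelyIrreducible_baseChange_of_goodSS_of_split` — the same with that clause discharged by «`p` splits
  in `K`» (`p ∤ d_K`).
* `smallImage_irrK` / `smallImage_irrK_framed` — the readings on item 4's binders (`ClassX7 W p`, `p ≠ 2`; the
  hypotheses `¬ W.HasCM`, `a_p = 0`, `¬ Surj W p` of the crux are not needed and not taken).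

What is NOT here: anything about the Heegner / BDP or Beilinson–Flach objects themselves; no new definition,
no named fact; nothing booked; crux 4 and item 4 stay OPEN.

References: [MatarNekovar2019] Prop. 5.26 (2)–(3) (JTNB 31 (2019) p. 492, proof p. 493); [Serre1972] §1.11
Prop. 12; [BurungaleCastellaSkinner2025] §4.2 (irr_K); [BurungaleSkinnerTianWan2024] Part II image clause.
-/

set_option autoImplicit false
set_option linter.dupNamespace false

noncomputable section

open scoped Classical NumberField

open WeierstrassCurve Literature.NumberTheory.EllipticCurves Literature.NumberTheory.GaloisRepresentations
  Literature.NumberTheory.EllipticCurves.Rank1Residual Literature.NumberTheory.EllipticCurves.MatarNekovar2019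

namespace Summit.BirchSwinnertonDyer.BirchSwinnertonDyer.Theorems.SmallImageIrrK

variable (W : WeierstrassCurve ℚ) [W.IsElliptic] [W.IsGloballyMinimal] (p : ℕ) [Fact p.Prime]

omit [W.IsElliptic] [W.IsGloballyMinimal] in
/-- The integer coprimality `(N_E, d_K) = 1` in the package's spelling (`IsCoprime (N : ℤ) d_K` with
`N = N_E`) is Matar–Nekovář's `Nat.Coprime N_E |d_K|`. [folklore] -/
theorem coprime_natAbs_of_isCoprime {K : Type} [Field K] [NumberField K] {N : ℕ}
    (hN : (N : ℤ) = W.conductorNorm ℤ) (hcop : IsCoprime (N : ℤ) (NumberField.discr K)) :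
    Nat.Coprime (W.conductorNorm ℤ) (NumberField.discr K).natAbs := by
  have h := hcop
  rw [Int.isCoprime_iff_gcd_eq_one, Int.gcd_eq_natAbs, Int.natAbs_natCast] at h
  have hNn : N = W.conductorNorm ℤ := by exact_mod_cast hN
  rwa [hNn] at h

/-- **(irr_K) at a good supersingular odd `p`, no image hypothesis.** For `E = W/ℚ` globally minimal with good
reduction at `p ≠ 2` and `p ∣ a_p`, and a quadratic field `K` (`[K : ℚ] = 2`) with `(N_E, d_K) = 1`:
`E_K[p]` is an irreducible `𝔽_p[Γ_K]`-module. Serre Prop. 12 (irreducible over `ℚ`) + Matar–Nekovář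
Prop. 5.26 (2) (tree-proved). [cite: Serre1972, §1.11 Prop. 12] [cite: MatarNekovar2019, Prop. 5.26 (2) (p. 492)] -/
theorem hasIrreducibleModPGaloisRep_baseChange_of_goodSS_of_isCoprime (hp2 : p ≠ 2)
    (hgood : W.HasGoodReductionAtPrime p) (hap : (p : ℤ) ∣ W.frobeniusTrace p)
    (K : Type) [Field K] [NumberField K] (hK2 : Module.finrank ℚ K = 2) {N : ℕ}
    (hN : (N : ℤ) = W.conductorNorm ℤ) (hcop : IsCoprime (N : ℤ) (NumberField.discr K)) :
    (W.baseChange K).HasIrreducibleModPGaloisRep p := by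
  have hirr : W.HasIrreducibleModPGaloisRep p :=
    hasIrreducibleModPGaloisRep_of_dvd_frobeniusTrace W p hp2
      (W.not_dvd_minimalDiscriminantInt_of_hasGoodReductionAtPrime' p hgood) hap
  exact prop526_hasIrreducibleModPGaloisRep_baseChange_holds W K hK2
    (coprime_natAbs_of_isCoprime W hN hcop) p hp2 hirr

/-- **Absolute irreducibility of every framing of `E_K[p]` at a good supersingular odd `p`, away from
`(p, d_K) = (3, -3)`.** Same hypotheses plus `¬ (p = 3 ∧ d_K = -3)`: every `ρ : Γ_K → GL₂(𝔽_p)` framing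
`E_K[p]` (`(W.baseChange K).IsTorsionGaloisRep p ρ`) is `FramedRep.IsAbsolutelyIrreducible`. Matar–Nekovář
Prop. 5.26 (2) ∘ (3) (tree-proved). [cite: MatarNekovar2019, Prop. 5.26 (2) and (3) (p. 492)] [cite: Serre1972, §1.11 Prop. 12] -/
theorem isAbsolutelyIrreducible_baseChange_of_goodSS_of_isCoprime (hp2 : p ≠ 2)
    (hgood : W.HasGoodReductionAtPrime p) (hap : (p : ℤ) ∣ W.frobeniusTrace p)
    (K : Type) [Field K] [NumberField K] (hK2 : Module.finrank ℚ K = 2) {N : ℕ}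
    (hN : (N : ℤ) = W.conductorNorm ℤ) (hcop : IsCoprime (N : ℤ) (NumberField.discr K))
    (h33 : ¬ (p = 3 ∧ NumberField.discr K = -3))
    (ρ : ModPGaloisRep K (ZMod p) 2) (hρ : (W.baseChange K).IsTorsionGaloisRep p ρ) :
    FramedRep.IsAbsolutelyIrreducible ρ := by
  have hirr : W.HasIrreducibleModPGaloisRep p :=
    hasIrreducibleModPGaloisRep_of_dvd_frobeniusTrace W p hp2
      (W.not_dvd_minimalDiscriminantInt_of_hasGoodReductionAtPrime' p hgood) hap
  exact isAbsolutelyIrreducible_baseChange_of_irreducible prop526_hasIrreducibleModPGaloisRep_baseChange_holds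
    prop526_three_of_irreducible_of_not_isAbsolutelyIrreducible_holds W K hK2
    (coprime_natAbs_of_isCoprime W hN hcop) p hp2 h33 hirr ρ hρ

/-- **… with the exception discharged by «`p` splits in `K`».** If `p` splits in `K` (two primes of `𝓞_K`
above `p` — the auxiliary fields of every two-variable road) then `p ∤ d_K`, so `(p, d_K) ≠ (3, -3)` and every
framing of `E_K[p]` is absolutely irreducible. [cite: MatarNekovar2019, Prop. 5.26 (2) and (3) (p. 492)]
[cite: NeukirchANT1999, Ch. III Cor. (2.12) (split primes are unramified)] -/
theorem isAbsolutelyIrreducible_baseChange_of_goodSS_of_split (hp2 : p ≠ 2)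
    (hgood : W.HasGoodReductionAtPrime p) (hap : (p : ℤ) ∣ W.frobeniusTrace p)
    (K : Type) [Field K] [NumberField K] (hK2 : Module.finrank ℚ K = 2) {N : ℕ}
    (hN : (N : ℤ) = W.conductorNorm ℤ) (hcop : IsCoprime (N : ℤ) (NumberField.discr K))
    (hsplit : ((Ideal.span {(p : ℤ)}).primesOver (𝓞 K)).ncard = 2)
    (ρ : ModPGaloisRep K (ZMod p) 2) (hρ : (W.baseChange K).IsTorsionGaloisRep p ρ) :
    FramedRep.IsAbsolutelyIrreducible ρ := by
  refine isAbsolutelyIrreducible_baseChange_of_goodSS_of_isCoprime W p hp2 hgood hap K hK2 hN hcop ?_ ρ hρ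
  rintro ⟨rfl, hd⟩
  have hnd : ¬ ((3 : ℕ) : ℤ) ∣ NumberField.discr K :=
    not_dvd_discr_of_ncard_primesOver_eq_two hK2 Fact.out hsplit
  exact hnd ⟨-1, by rw [hd]; norm_num⟩

/-! ### Readings on item 4's binders -/

/-- **(irr_K) on item 4's domain.** For an X7 pair `(W, p)` with `p ≠ 2` (good supersingular; the crux's further
hypotheses `¬ W.HasCM`, `a_p = 0`, `ρ̄` not onto are not needed) and a quadratic `K` with `(N, d_K) = 1`:
`E_K[p]` is irreducible. Replaces `Rank1Residual.irrK_of_surj` where `Surj W p` fails.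
[cite: MatarNekovar2019, Prop. 5.26 (2) (p. 492)] [cite: Serre1972, §1.11 Prop. 12] -/
theorem smallImage_irrK (hp2 : p ≠ 2) (hX : ClassX7 W p)
    (K : Type) [Field K] [NumberField K] (hK2 : Module.finrank ℚ K = 2) {N : ℕ}
    (hN : (N : ℤ) = W.conductorNorm ℤ) (hcop : IsCoprime (N : ℤ) (NumberField.discr K)) :
    (W.baseChange K).HasIrreducibleModPGaloisRep p :=
  hasIrreducibleModPGaloisRep_baseChange_of_goodSS_of_isCoprime W p hp2 hX.1.1 hX.1.2 K hK2 hN hcop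

/-- **Absolute irreducibility of every framing of `E_K[p]` on item 4's domain**, for `K` quadratic with
`(N, d_K) = 1` and `p` split in `K`. Replaces `…SignedBaseChangeK1FrameData.irrK_framed_of_surj` where
`Surj W p` fails — the image clause of the BSTW two-variable signed package and of the «acns» twins
(`AcnsSketch.lean` T1–T3) is met on the WHOLE small-image domain, every `p`.
[cite: MatarNekovar2019, Prop. 5.26 (2) and (3) (p. 492)] [cite: Serre1972, §1.11 Prop. 12] -/
theorem smallImage_irrK_framed (hp2 : p ≠ 2) (hX : ClassX7 W p)
    (K : Type) [Field K] [NumberField K] (hK2 : Module.finrank ℚ K = 2) {N : ℕ}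
    (hN : (N : ℤ) = W.conductorNorm ℤ) (hcop : IsCoprime (N : ℤ) (NumberField.discr K))
    (hsplit : ((Ideal.span {(p : ℤ)}).primesOver (𝓞 K)).ncard = 2)
    (ρ : ModPGaloisRep K (ZMod p) 2) (hρ : (W.baseChange K).IsTorsionGaloisRep p ρ) :
    FramedRep.IsAbsolutelyIrreducible ρ :=
  isAbsolutelyIrreducible_baseChange_of_goodSS_of_split W p hp2 hX.1.1 hX.1.2 K hK2 hN hcop hsplit ρ hρ

end Summit.BirchSwinnertonDyer.BirchSwinnertonDyer.Theorems.SmallImageIrrK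

end
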